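import Literature.AlgebraicGeometry.ModuliOfAbelianVarieties.SiegelPrincipalLevelOpen
import Literature.AlgebraicGeometry.ModuliOfAbelianVarieties.SiegelPrincipalLevelNormal
import Literature.NumberTheory.Automorphic.GLnAdelicStructureProofs
import HarnessLib

/-!
# The principal levels `K_δ(N) ≤ GSp_δ(𝔸_{ℚ,f})` are compact, and `[K_δ(N) : K_δ(N')] < ∞`

Topic `AlgebraicGeometry/ModuliOfAbelianVarieties`; namespace `Literature.AlgebraicGeometry.ModuliOfAbelianVarieties`.
THEOREMS ONLY (no definition, no named fact, no instance, no `sorry`) over ★ (σ1)/(σ3) `SymplecticSimilitudeGroup` /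
`SiegelComplexRecordSystem` (`similitudeGroupOfForm`, `gspFinAdelic δ`, `IsCongOne`, `principalLevelSubgroup δ N = K_δ(N)`),
★ `SiegelPrincipalLevelOpen` (`K_δ(N)` open, `N·𝓞̂` closed, `N` a unit of `𝔸_{ℚ,f}`), ★ `SiegelPrincipalLevelNormal`
(`isIntegral_of_isCongOne_one`) and ★ `Automorphic.GLnAdelicStructureProofs` (`isCompact_integralFiniteAdeles`: `𝓞̂_K` compact).

* §1 `isClosed_symplecticGroupOfForm` (no hypothesis) and **`isClosed_similitudeGroupOfForm`** — for a Hausdorff topological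
  commutative ring `R` and a Gram matrix `E` with `det E` a unit and ONE unit entry `E i j`, the similitude group `GSp(E)(R)`
  is CLOSED in `GL_n(R)`: the multiplier of `g` is the continuous function `ν(g) = (gᵀ E g)ᵢⱼ · (Eᵢⱼ)⁻¹`
  (`IsMultiplier.coe_eq_apply_mul_inv`), and `ν(g)^n = (det g)²` forces `ν(g)` to be a unit
  (`isUnit_of_transpose_mul_mul_eq_smul`), so the «`∃ ν` unit» of ★ `similitudeGroupOfForm` is the closed equation
  `gᵀ E g = ν(g) • E`.
* §2 `isCompact_integralAdeles`, `isCompact_units_matrix_integralAdeles` (`GL_m(𝓞̂)` compact), `isClosed_setOf_isCongOne`,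
  `isUnit_typeFormOver_inl_inr`, `isUnit_det_typeFormOver`, `isClosed_gspFinAdelic`, and
  **`isCompact_principalLevelSubgroup δ hg hδ hN`** — `K_δ(N)` is COMPACT for `N ≠ 0`, `0 < g`, `0 < δ i` (a closed subset of
  the compact `GL_{2g}(𝓞̂) = {γ | γ, γ⁻¹ ∈ M_{2g}(𝓞̂)}`, Mathlib `Submonoid.units_isCompact`); `compactSpace_principalLevelSubgroup`.
* §3 **`finite_quotient_principalLevelSubgroup`** — for `N, N' ≠ 0` the quotient `K_δ(N) / (K_δ(N') ∩ K_δ(N))` is FINITE (an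
  open subgroup of a compact group: Mathlib `Subgroup.quotient_finite_of_isOpen`), the `FiniteIndex` / `relIndex ≠ 0`
  spellings, and `finite_quotient_subgroupOf_of_isOpen` for ANY open subgroup `U` of `GSp_δ(𝔸_{ℚ,f})`.

Printed anchors: [Deligne1971TravauxShimura] Exemple 4.16 p. 150 («`K(N) = {g ∈ CSp(V̂_ℤ) | g ≡ 1 mod N}`», a compact open
subgroup of `G(𝔸_f)`), 1.8 p. 129 (levels of finite index in one another); [PlatonovRapinchuk1994] Ch. 5 §5.1
(`G(𝔸_f) ∩ ∏ GL_n(𝒪_v)` compact open; congruence subgroups have finite index); [Milne2005ShimuraVarieties] §6 p. 67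
(`GSp(ψ)`, `ν(g)`), Lemma 5.12 p. 57 (compact open `K` — the input of the finiteness of `G(ℚ)\G(𝔸_f)/K`).
Cell `hodgecm-mathlib`, #60 road (A-p05 TABLE «compact levels / finite index»): consumers = M2 of the Mumford line (level
transitions as FINITE quotients by `K_δ(N)/K_δ(N')`) and the piece-index finiteness (R60-13).  Banked generic leaf, books 0.
HC_CM is proved only modulo the 7 printed citations until rung 0 closes.

## References
* [Deligne1971TravauxShimura] P. Deligne, *Travaux de Shimura*, Sém. Bourbaki 389 (1971), 1.8 p. 129, Exemple 4.16 p. 150.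
* [PlatonovRapinchuk1994] V. Platonov, A. Rapinchuk, *Algebraic groups and number theory* (1994), Ch. 5 §5.1.
* [Milne2005ShimuraVarieties] J. S. Milne, *Introduction to Shimura varieties* (2005), §6 p. 67, Lemma 5.12 p. 57.
-/

set_option autoImplicit false

noncomputable section

open Matrix NumberField IsDedekindDomain
open _root_.Topology
open scoped RestrictedProduct

namespace Literature.AlgebraicGeometry.ModuliOfAbelianVarieties

/-! ### §1. `GSp(E)(R)` and `Sp(E)(R)` are closed in `GL_n(R)` -/

section Closed

variable {R : Type*} [CommRing R] [TopologicalSpace R] [IsTopologicalRing R]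
variable {n : Type*} [Fintype n] [DecidableEq n]

/-- The map `g ↦ gᵀ E g` on `GL_n(R)` is continuous. [cite: PlatonovRapinchuk1994, Ch. 5 §5.1] -/
theorem continuous_transpose_mul_mul (E : Matrix n n R) :
    Continuous fun g : GL n R => (g : Matrix n n R)ᵀ * E * (g : Matrix n n R) :=
  ((Units.continuous_val.matrix_transpose).matrix_mul continuous_const).matrix_mul Units.continuous_val

/-- **`Sp(E)(R)` is closed in `GL_n(R)`** (`gᵀ E g = E` is a closed equation in a Hausdorff ring).
[cite: PlatonovRapinchuk1994, Ch. 5 §5.1] -/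
theorem isClosed_symplecticGroupOfForm [T2Space R] (E : Matrix n n R) :
    IsClosed (symplecticGroupOfForm E : Set (GL n R)) := by
  have h : (symplecticGroupOfForm E : Set (GL n R)) =
      {g : GL n R | (g : Matrix n n R)ᵀ * E * (g : Matrix n n R) = E} := by
    ext g
    exact mem_symplecticGroupOfForm_iff
  rw [h]
  exact isClosed_eq (continuous_transpose_mul_mul E) continuous_const

omit [TopologicalSpace R] [IsTopologicalRing R] in
/-- The multiplier is determined by one unit entry of `E`: if `gᵀ E g = ν • E` and `E i j` is a unit then
`ν = (gᵀ E g)ᵢⱼ · (Eᵢⱼ)⁻¹`. [cite: Milne2005ShimuraVarieties, §6 p. 67] -/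
theorem IsMultiplier.coe_eq_apply_mul_inv {E : Matrix n n R} {g : GL n R} {ν : Rˣ} (h : IsMultiplier E g ν) {i j : n}
    (hij : IsUnit (E i j)) :
    (ν : R) = ((g : Matrix n n R)ᵀ * E * (g : Matrix n n R)) i j * ((hij.unit⁻¹ : Rˣ) : R) := by
  rw [isMultiplier_iff] at h
  rw [h, Matrix.smul_apply, smul_eq_mul, mul_assoc, IsUnit.mul_val_inv, mul_one]

omit [TopologicalSpace R] [IsTopologicalRing R] in
/-- **Units from powers**: in `GL_n(R)`, if `gᵀ E g = c • E` with `det E` a unit and `n` non-empty, then `c` is a unit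
(`(det g)² · det E = c ^ n · det E`). [cite: Milne2005ShimuraVarieties, §6 p. 67] -/
theorem isUnit_of_transpose_mul_mul_eq_smul [Nonempty n] {E : Matrix n n R} (hdet : IsUnit E.det) {g : GL n R} {c : R}
    (h : (g : Matrix n n R)ᵀ * E * (g : Matrix n n R) = c • E) : IsUnit c := by
  have hd := congrArg Matrix.det h
  rw [Matrix.det_mul, Matrix.det_mul, Matrix.det_transpose, Matrix.det_smul] at hd
  have hg : IsUnit (g : Matrix n n R).det := Matrix.isUnits_det_units g
  have h1 : IsUnit ((g : Matrix n n R).det * E.det * (g : Matrix n n R).det) := (hg.mul hdet).mul hg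
  rw [hd] at h1
  exact (isUnit_pow_iff Fintype.card_ne_zero).1 (isUnit_of_mul_isUnit_left h1)

/-- **`GSp(E)(R)` is closed in `GL_n(R)`** when `det E` is a unit and some entry `E i j` is a unit (e.g. a non-degenerate
alternating form with a unit coefficient — the type-`δ` form over any `ℚ`-algebra): then
`GSp(E)(R) = {g | gᵀ E g = ν(g) • E}` for the continuous `ν(g) = (gᵀ E g)ᵢⱼ (Eᵢⱼ)⁻¹`, a closed equation.
[cite: PlatonovRapinchuk1994, Ch. 5 §5.1] [cite: Milne2005ShimuraVarieties, §6 p. 67] -/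
theorem isClosed_similitudeGroupOfForm [T2Space R] {E : Matrix n n R} (hdet : IsUnit E.det) {i j : n}
    (hij : IsUnit (E i j)) : IsClosed (similitudeGroupOfForm E : Set (GL n R)) := by
  haveI : Nonempty n := ⟨i⟩
  -- the continuous multiplier candidate
  set c : GL n R → R := fun g => ((g : Matrix n n R)ᵀ * E * (g : Matrix n n R)) i j * ((hij.unit⁻¹ : Rˣ) : R)
    with hc_def
  have hc : Continuous c := ((continuous_transpose_mul_mul E).matrix_elem i j).mul continuous_const
  have h : (similitudeGroupOfForm E : Set (GL n R)) =
      {g : GL n R | (g : Matrix n n R)ᵀ * E * (g : Matrix n n R) = c g • E} := by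
    ext g
    simp only [SetLike.mem_coe, Set.mem_setOf_eq]
    constructor
    · rintro ⟨ν, hν⟩
      have hνc : (ν : R) = c g := hν.coe_eq_apply_mul_inv hij
      rw [← hνc]
      exact hν
    · intro hg
      obtain ⟨u, hu⟩ := isUnit_of_transpose_mul_mul_eq_smul hdet hg
      exact ⟨u, by rw [isMultiplier_iff, hu, hg]⟩
  rw [h]
  exact isClosed_eq (continuous_transpose_mul_mul E) (hc.smul continuous_const)

end Closed

/-! ### §2. `K_δ(N)` is compact -/

section Compact

/-- **`𝓞̂_K = ∏_v 𝓞_v` is compact** in `𝔸_{K,f}` (FLT's `FiniteAdeleRing.integralAdeles`; same carrier as the tree's ★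
`Automorphic.integralFiniteAdeles K`, compact by ★ `Automorphic.isCompact_integralFiniteAdeles` — Tychonoff over the compact
`𝓞_v`). [cite: PlatonovRapinchuk1994, Ch. 5 §5.1] -/
theorem isCompact_integralAdeles (K : Type) [Field K] [NumberField K] :
    IsCompact (FiniteAdeleRing.integralAdeles (𝓞 K) K : Set (FiniteAdeleRing (𝓞 K) K)) := by
  have h : (FiniteAdeleRing.integralAdeles (𝓞 K) K : Set (FiniteAdeleRing (𝓞 K) K)) =
      (Literature.NumberTheory.Automorphic.integralFiniteAdeles K : Set (FiniteAdeleRing (𝓞 K) K)) := by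
    rw [Literature.NumberTheory.Automorphic.coe_integralFiniteAdeles_eq_range_structureMap]
    rfl
  rw [h]
  exact Literature.NumberTheory.Automorphic.isCompact_integralFiniteAdeles K

/-- `𝔸_{ℚ,f}` is Hausdorff (it is the restricted product of the Hausdorff `ℚ_v`; stated as a theorem, used via `haveI`).
[cite: PlatonovRapinchuk1994, Ch. 5 §5.1] -/
theorem t2Space_finAdeleQ : T2Space finAdeleQ :=
  inferInstanceAs <| T2Space <| Πʳ v : HeightOneSpectrum (𝓞 ℚ), [v.adicCompletion ℚ, v.adicCompletionIntegers ℚ]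

variable {m : Type} [Fintype m] [DecidableEq m]

/-- **`GL_m(𝓞̂) = {γ ∈ GL_m(𝔸_{ℚ,f}) | γ, γ⁻¹ ∈ M_m(𝓞̂)}` is compact** (units of the compact monoid `M_m(𝓞̂)` in the Hausdorff
ring `M_m(𝔸_{ℚ,f})`: Mathlib `Submonoid.units_isCompact`, `IsCompact.matrix`). [cite: PlatonovRapinchuk1994, Ch. 5 §5.1] -/
theorem isCompact_units_matrix_integralAdeles :
    IsCompact ((((FiniteAdeleRing.integralAdeles (𝓞 ℚ) ℚ).matrix : Subring (Matrix m m finAdeleQ)).toSubmonoid.units :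
      Subgroup (GL m finAdeleQ)) : Set (GL m finAdeleQ)) :=
  haveI := t2Space_finAdeleQ
  Submonoid.units_isCompact (isCompact_integralAdeles ℚ).matrix

/-- Membership in `GL_m(𝓞̂)`: `γ` and `γ⁻¹` have integral entries. [cite: PlatonovRapinchuk1994, Ch. 5 §5.1] -/
theorem mem_units_matrix_integralAdeles_iff (γ : GL m finAdeleQ) :
    γ ∈ (((FiniteAdeleRing.integralAdeles (𝓞 ℚ) ℚ).matrix : Subring (Matrix m m finAdeleQ)).toSubmonoid.units :
      Subgroup (GL m finAdeleQ)) ↔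
      (∀ i j, (γ : Matrix m m finAdeleQ) i j ∈ FiniteAdeleRing.integralAdeles (𝓞 ℚ) ℚ) ∧
        ∀ i j, ((γ⁻¹ : GL m finAdeleQ) : Matrix m m finAdeleQ) i j ∈ FiniteAdeleRing.integralAdeles (𝓞 ℚ) ℚ :=
  Iff.rfl

omit [Fintype m] in
/-- **`A ≡ 1 (mod N)` is a closed condition** on `M_m(𝔸_{ℚ,f})` for `N ≠ 0` (finitely many entries in the closed `N·𝓞̂`).
[cite: Deligne1971TravauxShimura, Exemple 4.16 p. 150] -/
theorem isClosed_setOf_isCongOne {N : ℕ} (hN : N ≠ 0) : IsClosed {A : Matrix m m finAdeleQ | IsCongOne N A} := by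
  have h : {A : Matrix m m finAdeleQ | IsCongOne N A} =
      ⋂ i : m, ⋂ j : m, (fun A : Matrix m m finAdeleQ => (A - 1) i j) ⁻¹' (levelIdeal N : Set finAdeleQ) := by
    ext A
    simp only [Set.mem_setOf_eq, Set.mem_iInter, Set.mem_preimage, SetLike.mem_coe]
    rfl
  rw [h]
  refine isClosed_iInter fun i => isClosed_iInter fun j => ?_
  exact (isClosed_levelIdeal hN).preimage ((continuous_id.sub continuous_const).matrix_elem i j)

/-- The set `{γ ∈ GL_m(𝔸_{ℚ,f}) | γ ≡ 1, γ⁻¹ ≡ 1 (mod N)}` is closed (`N ≠ 0`). [cite: Deligne1971TravauxShimura, Exemple 4.16 p. 150] -/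
theorem isClosed_setOf_isCongOne_units {N : ℕ} (hN : N ≠ 0) :
    IsClosed {γ : GL m finAdeleQ | IsCongOne N (γ : Matrix m m finAdeleQ) ∧
      IsCongOne N ((γ⁻¹ : GL m finAdeleQ) : Matrix m m finAdeleQ)} :=
  ((isClosed_setOf_isCongOne hN).preimage Units.continuous_val).inter
    ((isClosed_setOf_isCongOne hN).preimage Units.continuous_coe_inv)

/-- `{γ | γ ≡ 1, γ⁻¹ ≡ 1 (mod N)} ⊆ GL_m(𝓞̂)` (a matrix `≡ 1 (mod N·𝓞̂)` is integral).
[cite: Deligne1971TravauxShimura, Exemple 4.16 p. 150] -/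
theorem setOf_isCongOne_units_subset (N : ℕ) :
    {γ : GL m finAdeleQ | IsCongOne N (γ : Matrix m m finAdeleQ) ∧
        IsCongOne N ((γ⁻¹ : GL m finAdeleQ) : Matrix m m finAdeleQ)} ⊆
      ((((FiniteAdeleRing.integralAdeles (𝓞 ℚ) ℚ).matrix : Subring (Matrix m m finAdeleQ)).toSubmonoid.units :
        Subgroup (GL m finAdeleQ)) : Set (GL m finAdeleQ)) := by
  rintro γ ⟨h1, h2⟩
  rw [SetLike.mem_coe, mem_units_matrix_integralAdeles_iff]
  exact ⟨isIntegral_of_isCongOne_one (h1.of_dvd (one_dvd N)), isIntegral_of_isCongOne_one (h2.of_dvd (one_dvd N))⟩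

/-- `{γ ∈ GL_m(𝔸_{ℚ,f}) | γ ≡ 1, γ⁻¹ ≡ 1 (mod N)}` is compact for `N ≠ 0`. [cite: Deligne1971TravauxShimura, Exemple 4.16 p. 150]
[cite: PlatonovRapinchuk1994, Ch. 5 §5.1] -/
theorem isCompact_setOf_isCongOne_units {N : ℕ} (hN : N ≠ 0) :
    IsCompact {γ : GL m finAdeleQ | IsCongOne N (γ : Matrix m m finAdeleQ) ∧
      IsCongOne N ((γ⁻¹ : GL m finAdeleQ) : Matrix m m finAdeleQ)} :=
  isCompact_units_matrix_integralAdeles.of_isClosed_subset (isClosed_setOf_isCongOne_units hN)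
    (setOf_isCongOne_units_subset N)

variable {g : ℕ} (δ : Fin g → ℕ)

/-- One unit entry of `E_δ` over `𝔸_{ℚ,f}`: `E_δ (λ_i, μ_i) = δ_i`, a unit for `0 < δ_i`.
[cite: Deligne1971TravauxShimura, Exemple 4.16 p. 150] -/
theorem isUnit_typeFormOver_inl_inr {i : Fin g} (hδ : 0 < δ i) :
    IsUnit (typeFormOver δ finAdeleQ (Sum.inl i) (Sum.inr i)) := by
  rw [typeFormOver_apply, typeForm, Matrix.fromBlocks_apply₁₂, Matrix.diagonal_apply_eq, Int.cast_natCast]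
  exact isUnit_natCast_finAdeleQ hδ.ne'

/-- `det E_δ` is a unit over `𝔸_{ℚ,f}` for a type with `0 < δ_i`: `E_δ` has the two-sided inverse `(0 -Δ⁻¹; Δ⁻¹ 0)`.
[cite: Deligne1971TravauxShimura, Exemple 4.16 p. 150] -/
theorem isUnit_det_typeFormOver (hδ : ∀ i, 0 < δ i) : IsUnit (typeFormOver δ finAdeleQ).det := by
  -- the inverse entries
  let u : Fin g → finAdeleQˣ := fun i => (isUnit_natCast_finAdeleQ (hδ i).ne').unit
  have hu : ∀ i, (u i : finAdeleQ) = δ i := fun i => rfl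
  have hE : typeFormOver δ finAdeleQ =
      Matrix.fromBlocks 0 (Matrix.diagonal fun i : Fin g => (u i : finAdeleQ))
        (-Matrix.diagonal fun i : Fin g => (u i : finAdeleQ)) 0 := by
    ext a b
    rcases a with a | a <;> rcases b with b | b <;>
      simp [typeFormOver_apply, typeForm, Matrix.diagonal_apply, hu]
  have hinv : typeFormOver δ finAdeleQ *
      Matrix.fromBlocks 0 (-Matrix.diagonal fun i : Fin g => (((u i)⁻¹ : finAdeleQˣ) : finAdeleQ))
        (Matrix.diagonal fun i : Fin g => (((u i)⁻¹ : finAdeleQˣ) : finAdeleQ)) 0 = 1 := by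
    rw [hE, Matrix.fromBlocks_multiply, ← Matrix.fromBlocks_one]
    simp only [Matrix.zero_mul, Matrix.mul_zero, zero_add, add_zero, Matrix.mul_neg, Matrix.neg_mul, neg_neg,
      Matrix.diagonal_mul_diagonal, Units.mul_inv, Matrix.diagonal_one, neg_zero]
  exact Matrix.isUnit_det_of_right_inverse hinv

/-- **`GSp_δ(𝔸_{ℚ,f})` is closed in `GL_{2g}(𝔸_{ℚ,f})`** (for `0 < g`, `0 < δ_i`). [cite: PlatonovRapinchuk1994, Ch. 5 §5.1] -/
theorem isClosed_gspFinAdelic (hg : 0 < g) (hδ : ∀ i, 0 < δ i) :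
    IsClosed (gspFinAdelic δ : Set (GL (Fin g ⊕ Fin g) finAdeleQ)) :=
  haveI := t2Space_finAdeleQ
  isClosed_similitudeGroupOfForm (isUnit_det_typeFormOver δ hδ) (isUnit_typeFormOver_inl_inr δ (hδ ⟨0, hg⟩))

/-- The image of `K_δ(N)` in `GL_{2g}(𝔸_{ℚ,f})` is `GSp_δ(𝔸_{ℚ,f}) ∩ {γ | γ ≡ 1, γ⁻¹ ≡ 1 (mod N)}`.
[cite: Deligne1971TravauxShimura, Exemple 4.16 p. 150] -/
theorem image_coe_principalLevelSubgroup (N : ℕ) :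
    (Subtype.val '' (principalLevelSubgroup δ N : Set (gspFinAdelic δ))) =
      (gspFinAdelic δ : Set (GL (Fin g ⊕ Fin g) finAdeleQ)) ∩
        {γ : GL (Fin g ⊕ Fin g) finAdeleQ | IsCongOne N (γ : Matrix (Fin g ⊕ Fin g) (Fin g ⊕ Fin g) finAdeleQ) ∧
          IsCongOne N ((γ⁻¹ : GL (Fin g ⊕ Fin g) finAdeleQ) : Matrix (Fin g ⊕ Fin g) (Fin g ⊕ Fin g) finAdeleQ)} := by
  ext γ
  simp only [Set.mem_image, SetLike.mem_coe, Set.mem_inter_iff, Set.mem_setOf_eq]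
  constructor
  · rintro ⟨x, hx, rfl⟩
    exact ⟨x.2, (mem_principalLevelSubgroup_iff δ).1 hx⟩
  · rintro ⟨hγ, h⟩
    exact ⟨⟨γ, hγ⟩, (mem_principalLevelSubgroup_iff δ).2 h, rfl⟩

/-- **`K_δ(N)` is COMPACT** (in `GSp_δ(𝔸_{ℚ,f})` with its subspace topology) for `N ≠ 0`, `0 < g`, `0 < δ_i`: its image in
`GL_{2g}(𝔸_{ℚ,f})` is the closed subset `GSp_δ(𝔸_f) ∩ {γ ≡ 1, γ⁻¹ ≡ 1 (mod N)}` of the compact `GL_{2g}(𝓞̂)`.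
[cite: Deligne1971TravauxShimura, Exemple 4.16 p. 150] [cite: PlatonovRapinchuk1994, Ch. 5 §5.1] -/
theorem isCompact_principalLevelSubgroup (hg : 0 < g) (hδ : ∀ i, 0 < δ i) {N : ℕ} (hN : N ≠ 0) :
    IsCompact (principalLevelSubgroup δ N : Set (gspFinAdelic δ)) := by
  rw [Subtype.isCompact_iff, image_coe_principalLevelSubgroup]
  exact (isCompact_setOf_isCongOne_units hN).inter_left (isClosed_gspFinAdelic δ hg hδ)

/-- `K_δ(N)` is a compact space (`N ≠ 0`, `0 < g`, `0 < δ_i`). [cite: Deligne1971TravauxShimura, Exemple 4.16 p. 150] -/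
theorem compactSpace_principalLevelSubgroup (hg : 0 < g) (hδ : ∀ i, 0 < δ i) {N : ℕ} (hN : N ≠ 0) :
    CompactSpace (principalLevelSubgroup δ N) :=
  isCompact_iff_compactSpace.mp (isCompact_principalLevelSubgroup δ hg hδ hN)

/-- Siegel levels `K ∈ SiegelLevel δ` are compact. [cite: Deligne1971TravauxShimura, Exemple 4.16 p. 150] -/
theorem isCompact_siegelLevel (hg : 0 < g) (hδ : ∀ i, 0 < δ i) (K : SiegelLevel δ) :
    IsCompact ((K.1 : Subgroup (gspFinAdelic δ)) : Set (gspFinAdelic δ)) := by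
  rw [K.val_eq]
  exact isCompact_principalLevelSubgroup δ hg hδ (by have := K.three_le_N; omega)

end Compact

/-! ### §3. Finite index: `K_δ(N) / (K_δ(N') ∩ K_δ(N))` is finite -/

section FiniteIndex

variable {g : ℕ} (δ : Fin g → ℕ)

/-- An open subgroup `U` of `GSp_δ(𝔸_{ℚ,f})` meets `K_δ(N)` in an open subgroup of `K_δ(N)`.
[cite: Deligne1971TravauxShimura, 1.8 p. 129] -/
theorem isOpen_subgroupOf_principalLevelSubgroup (N : ℕ) {U : Subgroup (gspFinAdelic δ)} (hU : IsOpen (U : Set (gspFinAdelic δ))) :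
    IsOpen ((U.subgroupOf (principalLevelSubgroup δ N) : Subgroup (principalLevelSubgroup δ N)) :
      Set (principalLevelSubgroup δ N)) :=
  hU.preimage continuous_subtype_val

/-- **Any open subgroup `U` of `GSp_δ(𝔸_{ℚ,f})` has finite index in `K_δ(N)` after intersecting**: `K_δ(N) / (U ∩ K_δ(N))` is
finite (`N ≠ 0`, `0 < g`, `0 < δ_i`; open subgroup of a compact group). [cite: Deligne1971TravauxShimura, 1.8 p. 129]
[cite: PlatonovRapinchuk1994, Ch. 5 §5.1] -/
theorem finite_quotient_subgroupOf_of_isOpen (hg : 0 < g) (hδ : ∀ i, 0 < δ i) {N : ℕ} (hN : N ≠ 0)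
    {U : Subgroup (gspFinAdelic δ)} (hU : IsOpen (U : Set (gspFinAdelic δ))) :
    Finite (principalLevelSubgroup δ N ⧸ U.subgroupOf (principalLevelSubgroup δ N)) := by
  haveI := compactSpace_principalLevelSubgroup δ hg hδ hN
  exact Subgroup.quotient_finite_of_isOpen _ (isOpen_subgroupOf_principalLevelSubgroup δ N hU)

/-- **`K_δ(N) / (K_δ(N') ∩ K_δ(N))` is finite** for `N, N' ≠ 0` (`0 < g`, `0 < δ_i`); for `N ∣ N'` this is the level group
`K_δ(N)/K_δ(N')` of the transition `Sh_{K(N')} → Sh_{K(N)}`. [cite: Deligne1971TravauxShimura, 1.8 p. 129]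
[cite: PlatonovRapinchuk1994, Ch. 5 §5.1] -/
theorem finite_quotient_principalLevelSubgroup (hg : 0 < g) (hδ : ∀ i, 0 < δ i) {N N' : ℕ} (hN : N ≠ 0) (hN' : N' ≠ 0) :
    Finite (principalLevelSubgroup δ N ⧸ (principalLevelSubgroup δ N').subgroupOf (principalLevelSubgroup δ N)) :=
  finite_quotient_subgroupOf_of_isOpen δ hg hδ hN (isOpen_principalLevelSubgroup δ hN')

/-- `K_δ(N') ∩ K_δ(N)` has finite index in `K_δ(N)` (`FiniteIndex` spelling). [cite: Deligne1971TravauxShimura, 1.8 p. 129] -/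
theorem finiteIndex_subgroupOf_principalLevelSubgroup (hg : 0 < g) (hδ : ∀ i, 0 < δ i) {N N' : ℕ} (hN : N ≠ 0)
    (hN' : N' ≠ 0) : ((principalLevelSubgroup δ N').subgroupOf (principalLevelSubgroup δ N)).FiniteIndex :=
  haveI := finite_quotient_principalLevelSubgroup δ hg hδ hN hN'
  Subgroup.finiteIndex_of_finite_quotient

/-- `[K_δ(N) : K_δ(N') ∩ K_δ(N)] ≠ 0` (`relIndex` spelling). [cite: Deligne1971TravauxShimura, 1.8 p. 129] -/
theorem relIndex_principalLevelSubgroup_ne_zero (hg : 0 < g) (hδ : ∀ i, 0 < δ i) {N N' : ℕ} (hN : N ≠ 0) (hN' : N' ≠ 0) :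
    (principalLevelSubgroup δ N').relIndex (principalLevelSubgroup δ N) ≠ 0 :=
  (finiteIndex_subgroupOf_principalLevelSubgroup δ hg hδ hN hN').index_ne_zero

/-- The level quotient along a Siegel-level arrow `K' ≤ K` is finite: `K / (K' ∩ K)` finite for `K K' : SiegelLevel δ`.
[cite: Deligne1971TravauxShimura, 1.8 p. 129] -/
theorem finite_quotient_siegelLevel (hg : 0 < g) (hδ : ∀ i, 0 < δ i) (K K' : SiegelLevel δ) :
    Finite ((K.1 : Subgroup (gspFinAdelic δ)) ⧸ (K'.1 : Subgroup (gspFinAdelic δ)).subgroupOf K.1) := by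
  have hK : IsCompact ((K.1 : Subgroup (gspFinAdelic δ)) : Set (gspFinAdelic δ)) := isCompact_siegelLevel δ hg hδ K
  haveI : CompactSpace (K.1 : Subgroup (gspFinAdelic δ)) := isCompact_iff_compactSpace.mp hK
  have hK' : IsOpen ((K'.1 : Subgroup (gspFinAdelic δ)) : Set (gspFinAdelic δ)) := by
    rw [K'.val_eq]
    exact isOpen_principalLevelSubgroup δ (by have := K'.three_le_N; omega)
  exact Subgroup.quotient_finite_of_isOpen _ (hK'.preimage continuous_subtype_val)

end FiniteIndex

end Literature.AlgebraicGeometry.ModuliOfAbelianVarieties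

end
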